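import Literature.NumberTheory.Weil1964.AdelicMetaplecticRationalLift
import Literature.NumberTheory.GelbartRogawski1991.CompatibleSplitting
import HarnessLib

/-!
# Weil's canonical lift `𝐫₀` over the adelic Siegel parabolic `P_Y(𝔸) = M(𝔸)N(𝔸)`, and the compatible
# splitting of `Mp_ψ(W_𝔸)ᶜᵒⁿᵗ` over it

Topic `NumberTheory/Weil1964`; namespace `Literature.NumberTheory.Weil1964`.  KERNEL MATHEMATICS ONLY: definitions
with bodies and theorems; no `def … : Prop` record, no `axiom`, no proof hole; the cite tags are provenance for
kernel-checked statements.  (Lane `lit-hodgefound`, prover row P-C2-16, STAGE 1 of the staged construction of the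
compatible splitting [GelbartRogawski1991, Prop. 3.1.1] over a unitary dual pair — see the seat's `STATUS.md`; nothing
in this file is a statement about a unitary group.)

SETTING.  `F` a number field, `T ∈ M_n(𝔸_F)` with `IsUnit T.det`, `W_𝔸 = X_𝔸 × Y_𝔸`, `X_𝔸 = Y_𝔸 = 𝔸_Fⁿ`, with the
tree's symplectic form `polar (adelicForm F (Fin n) T)` (`adelicForm T x y = x ⬝ᵥ T y`), the global Schrödinger
representation `adelicSchrodinger F (Fin n) T` on `𝒮(X_𝔸) = piSchwartzBruhat F (Fin n)` (`AdelicHeisenbergSchrodinger`),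
the group `Mp_ψ(W_𝔸) = adelicMp` of implementing pairs `(g, M)`, its LF-continuous part `Mp_ψ(W_𝔸)ᶜᵒⁿᵗ = adelicMpCont`
(the metaplectic group OF RECORD), and Weil's `Θ`-forced rational section `r_F` (`AdelicMetaplecticGroup`,
`AdelicMetaplecticContinuous`, `AdelicMetaplecticGenerators`, `AdelicMetaplecticRationalLift`).

THE PRINTED MATHEMATICS.  [Weil1964, Chap. I n° 13, p. 160] (for ANY locally compact abelian `G`, here `G = X_𝔸`):
"*`d₀` et `t₀` sont des monomorphismes, dans `B₀(G)`, du groupe des automorphismes de `G`, et du groupe `X₂(G)`,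
respectivement; et … on a `d₀(α)⁻¹ t₀(f) d₀(α) = t₀(f^α)`, `d₀(αβ) = d₀(α) d₀(β)`*" — i.e. the operators
`d₀(α)Φ(x) = |α|^{1/2} Φ(xα)` (Levi) and `t₀(f)Φ(x) = Φ(x)f(x)` (multiplication by a character of the second degree)
give a HOMOMORPHIC lift of the subgroup `P₀(G) = {t₀(f) d₀(α)}` of `Sp(G)`; [Weil1964, Chap. III n° 46, (42) p. 202]:
every element of the "parabolic" subgroup `P(X)` is uniquely `t'(h) t(g) d(λ)`.  In the `p`-adic literature this is
[Rangarao1993, Thm 3.5 (2)–(3), p. 355]: "*`r(p)φ : x ↦ |a|^{1/2} f_p(x) φ(xa)`, when `p ∈ P`*" and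
"*`r(p₁σp₂) = r(p₁)r(σ)r(p₂)` for all `p₁, p₂ ∈ P`*" (so `r|_P` is a homomorphism; equivalently Thm 4.1 (1) p. 358:
`c(p₁σ₁p, p⁻¹σ₂p₂) = c(σ₁, σ₂)`, whence `c ≡ 1` on `P × P`), and the formulas
`A(m(a))φ(x) = |det a|^{1/2} φ(xa)`, `A(n(b))φ(x) = ψ(½⟨x, xb⟩) φ(x)` for `g ∈ P_Y = MN` [Kudla1996, I.2, proof of Prop. 2.3].

WHAT IS HERE (all proved):
* §1 `evalZeroLM` (`δ₀ : Φ ↦ Φ(0)`) and **`δ₀`-RIGIDITY** `deltaRigid_adelicSchrodinger`: a linear automorphism of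
  `𝒮(𝔸_F^ι)` commuting with the Heisenberg operators and fixing `δ₀` is the identity (commutation with the
  translations alone suffices; no hypothesis on `T`).  Hence (generic §1 of `AdelicMetaplecticGroup`) over the
  `δ₀`-liftable subgroup of `Sp(W_𝔸)` there is a UNIQUE `δ₀`-fixing homomorphic section — Weil's `𝐫₀` WITHOUT the
  modulus `|det a|^{1/2}` (the tree's normalisation of `leviPair`; the two normalisations differ by the central
  character `|det a|_𝔸^{1/2}`, trivial on rational points and on unitary adelic points).
* §2 (pure linear algebra over any commutative ring `K` with `2` invertible, Gram matrix `T` with `IsUnit T.det`)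
  the **Siegel parabolic** `siegelParabolicPi T = P_Y = {p ∈ Sp(K^ι × K^ι, polar β_T) | p Y = Y}` (`Y = 0 × K^ι`) and
  the **decomposition `p = m(a_p) · n(c_p)`** (`SiegelParabolicPi.eq_leviSp_mul_unipotentSp`) with
  `a_p ∈ GL_ι(K)` the matrix of `x ↦ (p(x,0)).1` and `c_p = a_pᵀ T d_p` symmetric (`d_p` the matrix of
  `x ↦ (p(x,0)).2`) — Weil's normal form (42) for `P(X)`; `p⁻¹(x, 0) = (a_p⁻¹x, −T⁻¹c_p a_p⁻¹ x)`.
* §3 (adelic) every `p ∈ P_Y(𝔸)` is `δ₀`-liftable (`leviPair`, `unipPair` fix `δ₀`), so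
  **`adelicSiegelLift T hT : P_Y(𝔸) →* Mp_ψ(W_𝔸)`** is defined, CHOICE-FREE; `adelicSiegelLift p = leviPair a_p · unipPair c_p`;
  its values lie in `Mp_ψ(W_𝔸)ᶜᵒⁿᵗ` (`adelicSiegelLiftCont`); the OPERATOR FORMULA
  `(ω(𝐫₀ p)Φ)(x) = ψ_F(½ β_T(u, v)) Φ(u)`, `(u, v) = p⁻¹(x, 0)` (`coe_toOp_adelicSiegelLift_symm`);
* §4 CONTINUITY: along any family `z ↦ p_z ∈ P_Y(𝔸)` whose orbit maps `z ↦ p_z w`, `z ↦ p_z⁻¹ w` are continuous,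
  `z ↦ 𝐫₀(p_z)` is continuous for the topology of `Mp_ψ(W_𝔸)` (initial for `π` and the matrix coefficients); in
  particular `𝐫₀` is continuous for the pointwise topology of `P_Y(𝔸)`;
* §5 RATIONALITY: on the subgroup `P_Y(F)` generated by the rational Levi and unipotent elements, `𝐫₀ = r_F`
  (both are `Θ`-fixing there; `Θ`-rigidity), and `P_Y(F) ⊆ Sp_F(W)`;
* §6 the **Siegel splitting datum** `siegelSplittingDatum F T hT : SplittingDatum Sp(W_𝔸) Mp_ψ(W_𝔸)ᶜᵒⁿᵗ P_Y(𝔸)`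
  (the abstract datum of `GelbartRogawski1991.CompatibleSplitting` with `G(𝐀) := P_Y(𝔸)`, `ι :=` inclusion,
  `G(F) := P_Y(F)`, `i := r_F`) and **`compatibleSplitting_siegelSplittingDatum`**: its `CompatibleSplitting` HOLDS —
  the record predicate `SplittingDatum.CompatibleSplitting` is thereby inhabited at a constructed adelic datum with
  NON-TRIVIAL `G(𝐀)` (the degenerate case `G(𝐀) = 1` is `SplittingDatum.compatibleSplitting_of_subsingleton` of
  `CompatibleSplittingDegenerate`).  This is NOT [GelbartRogawski1991, Prop. 3.1.1] (whose `G` is a unitary group);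
  it is the parabolic base case every construction of that splitting composes with (Rao's
  `r(g) = r(p₁) r(w_S) r(p₂)`; the doubling normalisation).

## References

* [Weil1964] A. Weil, *Sur certains groupes d'opérateurs unitaires*, Acta Math. 111 (1964) 143–211: Chap. I n° 6
  p. 151 (`P₀(G)`), n° 13 p. 160 (`d₀`, `t₀` are monomorphisms; `d₀(α)⁻¹t₀(f)d₀(α) = t₀(f^α)`); Chap. III n° 46
  pp. 201–202 ((42): normal form of `P(X)`), n° 40–41 pp. 190–193 (`r_k`, Θ-invariance).
* [Rangarao1993] R. Ranga Rao, *On some explicit formulas in the theory of Weil representation*, Pacific J. Math.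
  157 (1993) 335–371, §2.2 (`P`), Thm 3.5 (2)–(3) p. 355 (`r(p)`, `r(p₁σp₂) = r(p₁)r(σ)r(p₂)`), Thm 4.1 (1) p. 358.
* [Kudla1996] S. S. Kudla, *Notes on the local theta correspondence* (1996), Chap. I §2 (`P_Y = MN`, the operators
  `A(m(a))`, `A(n(b))`).
* [MoeglinVignerasWaldspurger1987] C. Mœglin, M.-F. Vignéras, J.-L. Waldspurger, LNM 1291, Chap. 2 II.2, II.6.
* [GelbartRogawski1991] S. Gelbart, J. Rogawski, Invent. Math. 105 (1991), §3.1 p. 454 (the datum `Sp ⊇ Sp_F`,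
  `Mp`, `π`, `i`).
-/

set_option autoImplicit false

noncomputable section

namespace Literature.NumberTheory.Weil1964

open Literature.RepresentationTheory.HeisenbergGroup
open Literature.RepresentationTheory.HeisenbergGroup.SymplecticMatrix
open Literature.GroupTheory.TwistedProduct (fixer mem_fixer_iff)
open Literature.NumberTheory.Automorphic
open NumberField
open scoped Matrix

/-! ## §1 `δ₀ = ` evaluation at `0`, and `δ₀`-rigidity of the global Schrödinger model -/

section EvalZero

variable (F : Type) [Field F] [NumberField F] (ι : Type) [Fintype ι]

/-- **`δ₀`**: evaluation at `0 ∈ X_𝔸`, `Φ ↦ Φ(0)`, a linear functional on `𝒮(𝔸_F^ι)`. [folklore] -/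
def evalZeroLM : piSchwartzBruhat F ι →ₗ[ℂ] ℂ where
  toFun Φ := (Φ : (ι → AdeleRing (𝓞 F) F) → ℂ) 0
  map_add' _ _ := rfl
  map_smul' _ _ := rfl

variable {F ι}

/-- formula. [cite: Weil1964, Chap. I n° 13 p. 160] -/
@[simp] theorem evalZeroLM_apply (Φ : piSchwartzBruhat F ι) :
    evalZeroLM F ι Φ = (Φ : (ι → AdeleRing (𝓞 F) F) → ℂ) 0 := rfl

variable (F ι) in
/-- **`δ₀`-RIGIDITY OF THE GLOBAL SCHRÖDINGER MODEL**: a linear automorphism `C` of `𝒮(𝔸_F^ι)` commuting with the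
Heisenberg operators `ρ_ψ(h)` and fixing `δ₀` (`(CΦ)(0) = Φ(0)`) is the identity — `(CΦ)(x) = (ρ(x,0)CΦ)(0) =
(C ρ(x,0)Φ)(0) = (ρ(x,0)Φ)(0) = Φ(x)`.  The hypothesis shape `ThetaRigid` of `AdelicMetaplecticGroup` §1 with `δ₀` in
place of `Θ`; no condition on `T`. [cite: Weil1964, Chap. I n° 13 p. 160] -/
theorem deltaRigid_adelicSchrodinger [DecidableEq ι] (T : Matrix ι ι (AdeleRing (𝓞 F) F)) :
    ThetaRigid (adelicSchrodinger F ι T) (evalZeroLM F ι : piSchwartzBruhat F ι → ℂ) := by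
  intro C hC hδ
  apply LinearEquiv.ext
  intro Φ
  apply Subtype.ext
  funext x
  have h1 := (mem_fixer_iff _ C).1 hδ
    (adelicSchrodinger F ι T (Heisenberg.ofVec (polar (adelicForm F ι T)) (x, 0)) Φ)
  rw [LinearEquiv.smul_def, hC, evalZeroLM_apply, evalZeroLM_apply, coe_adelicSchrodinger_ofVec_inl,
    coe_adelicSchrodinger_ofVec_inl, translate_apply, translate_apply, zero_add] at h1
  exact h1

end EvalZero

/-! ## §2 The Siegel parabolic `P_Y` of `Sp(K^ι × K^ι, polar β_T)` and the decomposition `p = m(a_p) n(c_p)` -/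

section Parabolic

variable {K : Type*} [CommRing K] {ι : Type*} [Fintype ι] [DecidableEq ι] (T : Matrix ι ι K)

local notation "𝕎" => (ι → K) × (ι → K)
local notation "Sp𝕎" => symplecticGroup (polar (Matrix.toLinearMap₂' K T))

omit [DecidableEq ι] in
/-- two square matrices with the same bilinear form `x ⬝ᵥ M y` are equal. [folklore] -/
private theorem matrix_eq_of_forall_dotProduct_mulVec {M N : Matrix ι ι K}
    (h : ∀ x y : ι → K, x ⬝ᵥ (M *ᵥ y) = x ⬝ᵥ (N *ᵥ y)) : M = N :=
  Matrix.ext_iff_mulVec.2 fun y => dotProduct_eq _ _ fun u => by rw [dotProduct_comm, h, dotProduct_comm]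

/-- **The Siegel parabolic `P_Y ≤ Sp(W)`**, `W = X × Y`, `X = Y = K^ι`, form `polar β_T`: the symplectic
automorphisms `p` with `p(Y) ⊆ Y` and `p⁻¹(Y) ⊆ Y` (`Y = 0 × K^ι`) — "The stabilizer of `Y` in `Sp(W)` is the (maximal
parabolic) subgroup `P_Y = MN`" [Kudla1996, I.2]; Weil's `P(X) = {s | γ(s) = 0}` [Weil1964, Chap. III n° 46].
[cite: Weil1964, Chap. III n° 46 p. 201] -/
def siegelParabolicPi : Subgroup Sp𝕎 where
  carrier := {p | (∀ y : ι → K, (((p : Sp𝕎) : 𝕎 ≃ₗ[K] 𝕎) (0, y)).1 = 0) ∧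
    ∀ y : ι → K, (((p : Sp𝕎) : 𝕎 ≃ₗ[K] 𝕎).symm (0, y)).1 = 0}
  one_mem' := ⟨fun _ => rfl, fun _ => rfl⟩
  mul_mem' {p q} hp hq := by
    refine ⟨fun y => ?_, fun y => ?_⟩
    · have hy : ((q : Sp𝕎) : 𝕎 ≃ₗ[K] 𝕎) (0, y) = (0, (((q : Sp𝕎) : 𝕎 ≃ₗ[K] 𝕎) (0, y)).2) :=
        Prod.ext (hq.1 y) rfl
      show (((p : Sp𝕎) : 𝕎 ≃ₗ[K] 𝕎) (((q : Sp𝕎) : 𝕎 ≃ₗ[K] 𝕎) (0, y))).1 = 0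
      rw [hy]
      exact hp.1 _
    · have hy : ((p : Sp𝕎) : 𝕎 ≃ₗ[K] 𝕎).symm (0, y) = (0, (((p : Sp𝕎) : 𝕎 ≃ₗ[K] 𝕎).symm (0, y)).2) :=
        Prod.ext (hp.2 y) rfl
      show (((q : Sp𝕎) : 𝕎 ≃ₗ[K] 𝕎).symm (((p : Sp𝕎) : 𝕎 ≃ₗ[K] 𝕎).symm (0, y))).1 = 0
      rw [hy]
      exact hq.2 _
  inv_mem' {p} hp := by
    refine ⟨fun y => hp.2 y, fun y => ?_⟩
    show (((p : Sp𝕎) : 𝕎 ≃ₗ[K] 𝕎).symm.symm (0, y)).1 = 0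
    rw [LinearEquiv.symm_symm]
    exact hp.1 y

variable {T}

/-- membership in `P_Y`: `p(0, y)` and `p⁻¹(0, y)` have zero `X`-component. [cite: Weil1964, Chap. III n° 46 p. 201] -/
theorem mem_siegelParabolicPi_iff (p : Sp𝕎) :
    p ∈ siegelParabolicPi T ↔
      (∀ y : ι → K, ((p : 𝕎 ≃ₗ[K] 𝕎) (0, y)).1 = 0) ∧ ∀ y : ι → K, ((p : 𝕎 ≃ₗ[K] 𝕎).symm (0, y)).1 = 0 :=
  Iff.rfl

variable (T) (hT : IsUnit T.det)

/-- the Levi elements `m(a) : (x, y) ↦ (a x, T⁻¹ a⁻ᵀ T y)` lie in `P_Y`. [cite: Kudla1996, I.2] -/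
theorem leviSp_mem_siegelParabolicPi (a : GL ι K) :
    leviSp (Matrix.toLinearMap₂' K T) (glEquiv a) (leviDual T hT a) (leviDual_compat T hT a) ∈
      siegelParabolicPi T := by
  refine ⟨fun y => ?_, fun y => ?_⟩
  · rw [coe_leviSp_apply, glEquiv_apply, Matrix.mulVec_zero]
  · have h : (leviSp (Matrix.toLinearMap₂' K T) (glEquiv a) (leviDual T hT a) (leviDual_compat T hT a) :
        𝕎 ≃ₗ[K] 𝕎).symm (0, y) = (0, (leviDual T hT a).symm y) := by
      rw [LinearEquiv.symm_apply_eq, coe_leviSp_apply, glEquiv_apply, Matrix.mulVec_zero,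
        LinearEquiv.apply_symm_apply]
    rw [h]

/-- the unipotent elements `n(c) : (x, y) ↦ (x, y + T⁻¹ c x)`, `c` symmetric, lie in `P_Y`. [cite: Kudla1996, I.2] -/
theorem unipotentSp_mem_siegelParabolicPi [Invertible (2 : K)] (c : Matrix ι ι K) (hc : c.IsSymm) :
    unipotentSp (Matrix.toLinearMap₂' K T) (lowLin T c) (lowLin_symm T hT c hc) ∈ siegelParabolicPi T := by
  refine ⟨fun y => ?_, fun y => ?_⟩
  · rw [coe_unipotentSp, unipotentσ_apply]
  · have h : (unipotentSp (Matrix.toLinearMap₂' K T) (lowLin T c) (lowLin_symm T hT c hc) :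
        𝕎 ≃ₗ[K] 𝕎).symm (0, y) = (0, y) := by
      rw [LinearEquiv.symm_apply_eq, coe_unipotentSp, unipotentσ_apply, map_zero, add_zero]
    rw [h]

namespace SiegelParabolicPi

variable {T}

/-- `a_p : x ↦ (p(x, 0)).1`, the `X → X` block of `p`. [cite: Weil1964, Chap. III n° 46 p. 202] -/
def aLin (p : Sp𝕎) : (ι → K) →ₗ[K] (ι → K) :=
  LinearMap.fst K (ι → K) (ι → K) ∘ₗ (p : 𝕎 ≃ₗ[K] 𝕎).toLinearMap ∘ₗ LinearMap.inl K (ι → K) (ι → K)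

/-- `x ↦ (p⁻¹(x, 0)).1`, the `X → X` block of `p⁻¹` (the inverse of `a_p` on `P_Y`). [folklore] -/
def aInvLin (p : Sp𝕎) : (ι → K) →ₗ[K] (ι → K) :=
  LinearMap.fst K (ι → K) (ι → K) ∘ₗ (p : 𝕎 ≃ₗ[K] 𝕎).symm.toLinearMap ∘ₗ LinearMap.inl K (ι → K) (ι → K)

/-- `d_p : x ↦ (p(x, 0)).2`, the `X → Y` block of `p`. [folklore] -/
def dLin (p : Sp𝕎) : (ι → K) →ₗ[K] (ι → K) :=
  LinearMap.snd K (ι → K) (ι → K) ∘ₗ (p : 𝕎 ≃ₗ[K] 𝕎).toLinearMap ∘ₗ LinearMap.inl K (ι → K) (ι → K)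

/-- `e_p : y ↦ (p(0, y)).2`, the `Y → Y` block of `p`. [folklore] -/
def eLin (p : Sp𝕎) : (ι → K) →ₗ[K] (ι → K) :=
  LinearMap.snd K (ι → K) (ι → K) ∘ₗ (p : 𝕎 ≃ₗ[K] 𝕎).toLinearMap ∘ₗ LinearMap.inr K (ι → K) (ι → K)

/-- formula. [cite: Weil1964, Chap. III n° 46 p. 202] -/
@[simp] theorem aLin_apply (p : Sp𝕎) (x : ι → K) : aLin p x = ((p : 𝕎 ≃ₗ[K] 𝕎) (x, 0)).1 := rfl

/-- formula. [cite: Weil1964, Chap. III n° 46 p. 202] -/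
@[simp] theorem aInvLin_apply (p : Sp𝕎) (x : ι → K) : aInvLin p x = ((p : 𝕎 ≃ₗ[K] 𝕎).symm (x, 0)).1 := rfl

/-- formula. [cite: Weil1964, Chap. III n° 46 p. 202] -/
@[simp] theorem dLin_apply (p : Sp𝕎) (x : ι → K) : dLin p x = ((p : 𝕎 ≃ₗ[K] 𝕎) (x, 0)).2 := rfl

/-- formula. [cite: Weil1964, Chap. III n° 46 p. 202] -/
@[simp] theorem eLin_apply (p : Sp𝕎) (y : ι → K) : eLin p y = ((p : 𝕎 ≃ₗ[K] 𝕎) (0, y)).2 := rfl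

/-- for `p ∈ P_Y`: `p(x, y) = (a_p x, d_p x + e_p y)`. [cite: Weil1964, Chap. III n° 46 p. 202] -/
theorem apply_eq {p : Sp𝕎} (hp : p ∈ siegelParabolicPi T) (x y : ι → K) :
    (p : 𝕎 ≃ₗ[K] 𝕎) (x, y) = (aLin p x, dLin p x + eLin p y) := by
  have hxy : ((x, y) : 𝕎) = (x, 0) + (0, y) := by
    rw [Prod.mk_add_mk, add_zero, zero_add]
  rw [hxy, map_add]
  refine Prod.ext ?_ ?_
  · rw [Prod.fst_add, hp.1 y, add_zero, aLin_apply]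
  · rw [Prod.snd_add, dLin_apply, eLin_apply]

/-- `a_p (p⁻¹(x,0)).1 = x` on `P_Y`. [cite: Weil1964, Chap. III n° 46 p. 202] -/
theorem aLin_aInvLin {p : Sp𝕎} (hp : p ∈ siegelParabolicPi T) (x : ι → K) : aLin p (aInvLin p x) = x := by
  have hsplit : ((((p : 𝕎 ≃ₗ[K] 𝕎).symm (x, 0)).1, 0) : 𝕎) =
      (p : 𝕎 ≃ₗ[K] 𝕎).symm (x, 0) - (0, ((p : 𝕎 ≃ₗ[K] 𝕎).symm (x, 0)).2) := by
    rw [Prod.ext_iff]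
    exact ⟨(sub_zero _).symm, (sub_self _).symm⟩
  rw [aLin_apply, aInvLin_apply, hsplit, map_sub, LinearEquiv.apply_symm_apply, Prod.fst_sub, hp.1, sub_zero]

/-- `(p⁻¹(a_p x, 0)).1 = x` on `P_Y`. [cite: Weil1964, Chap. III n° 46 p. 202] -/
theorem aInvLin_aLin {p : Sp𝕎} (hp : p ∈ siegelParabolicPi T) (x : ι → K) : aInvLin p (aLin p x) = x := by
  have hsplit : ((((p : 𝕎 ≃ₗ[K] 𝕎) (x, 0)).1, 0) : 𝕎) =
      (p : 𝕎 ≃ₗ[K] 𝕎) (x, 0) - (0, ((p : 𝕎 ≃ₗ[K] 𝕎) (x, 0)).2) := by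
    rw [Prod.ext_iff]
    exact ⟨(sub_zero _).symm, (sub_self _).symm⟩
  rw [aInvLin_apply, aLin_apply, hsplit, map_sub, LinearEquiv.symm_apply_apply, Prod.fst_sub, hp.2, sub_zero]

/-- the matrix `a_p` of `x ↦ (p(x,0)).1`. [cite: Weil1964, Chap. III n° 46 p. 202] -/
def aMat (p : Sp𝕎) : Matrix ι ι K := LinearMap.toMatrix' (aLin p)

/-- the matrix of `x ↦ (p⁻¹(x,0)).1`. [folklore] -/
def aInvMat (p : Sp𝕎) : Matrix ι ι K := LinearMap.toMatrix' (aInvLin p)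

/-- the matrix `d_p` of `x ↦ (p(x,0)).2`. [folklore] -/
def dMat (p : Sp𝕎) : Matrix ι ι K := LinearMap.toMatrix' (dLin p)

/-- the matrix `e_p` of `y ↦ (p(0,y)).2`. [folklore] -/
def eMat (p : Sp𝕎) : Matrix ι ι K := LinearMap.toMatrix' (eLin p)

/-- **`c_p := a_pᵀ T d_p`**, the symmetric matrix of the unipotent part of `p`. [cite: Weil1964, Chap. III n° 46 p. 202] -/
def cMat (p : Sp𝕎) : Matrix ι ι K := (aMat p)ᵀ * T * dMat p

/-- formula. [cite: Weil1964, Chap. III n° 46 p. 202] -/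
@[simp] theorem aMat_mulVec (p : Sp𝕎) (x : ι → K) : aMat p *ᵥ x = ((p : 𝕎 ≃ₗ[K] 𝕎) (x, 0)).1 := by
  rw [aMat, LinearMap.toMatrix'_mulVec, aLin_apply]

/-- formula. [cite: Weil1964, Chap. III n° 46 p. 202] -/
@[simp] theorem aInvMat_mulVec (p : Sp𝕎) (x : ι → K) : aInvMat p *ᵥ x = ((p : 𝕎 ≃ₗ[K] 𝕎).symm (x, 0)).1 := by
  rw [aInvMat, LinearMap.toMatrix'_mulVec, aInvLin_apply]

/-- formula. [cite: Weil1964, Chap. III n° 46 p. 202] -/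
@[simp] theorem dMat_mulVec (p : Sp𝕎) (x : ι → K) : dMat p *ᵥ x = ((p : 𝕎 ≃ₗ[K] 𝕎) (x, 0)).2 := by
  rw [dMat, LinearMap.toMatrix'_mulVec, dLin_apply]

/-- formula. [cite: Weil1964, Chap. III n° 46 p. 202] -/
@[simp] theorem eMat_mulVec (p : Sp𝕎) (y : ι → K) : eMat p *ᵥ y = ((p : 𝕎 ≃ₗ[K] 𝕎) (0, y)).2 := by
  rw [eMat, LinearMap.toMatrix'_mulVec, eLin_apply]

/-- `a_p · a_p⁻¹ = 1`. [cite: Weil1964, Chap. III n° 46 p. 202] -/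
theorem aMat_mul_aInvMat {p : Sp𝕎} (hp : p ∈ siegelParabolicPi T) : aMat p * aInvMat p = 1 := by
  have h : aLin p ∘ₗ aInvLin p = LinearMap.id := LinearMap.ext (aLin_aInvLin hp)
  rw [aMat, aInvMat, ← LinearMap.toMatrix'_comp, h, LinearMap.toMatrix'_id]

/-- `a_p⁻¹ · a_p = 1`. [cite: Weil1964, Chap. III n° 46 p. 202] -/
theorem aInvMat_mul_aMat {p : Sp𝕎} (hp : p ∈ siegelParabolicPi T) : aInvMat p * aMat p = 1 := by
  have h : aInvLin p ∘ₗ aLin p = LinearMap.id := LinearMap.ext (aInvLin_aLin hp)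
  rw [aMat, aInvMat, ← LinearMap.toMatrix'_comp, h, LinearMap.toMatrix'_id]

/-- **`a_p ∈ GL_ι(K)`** for `p ∈ P_Y` (inverse: the `X → X` block of `p⁻¹`). [cite: Weil1964, Chap. III n° 46 p. 202] -/
def aGL {p : Sp𝕎} (hp : p ∈ siegelParabolicPi T) : GL ι K :=
  ⟨aMat p, aInvMat p, aMat_mul_aInvMat hp, aInvMat_mul_aMat hp⟩

/-- formula. [cite: Weil1964, Chap. III n° 46 p. 202] -/
@[simp] theorem coe_aGL {p : Sp𝕎} (hp : p ∈ siegelParabolicPi T) : ((aGL hp : GL ι K) : Matrix ι ι K) = aMat p :=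
  rfl

/-- formula. [cite: Weil1964, Chap. III n° 46 p. 202] -/
@[simp] theorem coe_aGL_inv {p : Sp𝕎} (hp : p ∈ siegelParabolicPi T) :
    (((aGL hp)⁻¹ : GL ι K) : Matrix ι ι K) = aInvMat p := rfl

/-- the symplectic identity of `p` on `W = X × Y` for the form `polar β_T`:
`β(p w)₁ (p w')₂ − β(p w')₁ (p w)₂ = β w₁ w'₂ − β w'₁ w₂`. [cite: Weil1964, Chap. III n° 46 p. 201] -/
theorem sp_identity (p : Sp𝕎) (w w' : 𝕎) :
    ((p : 𝕎 ≃ₗ[K] 𝕎) w).1 ⬝ᵥ (T *ᵥ ((p : 𝕎 ≃ₗ[K] 𝕎) w').2) -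
        ((p : 𝕎 ≃ₗ[K] 𝕎) w').1 ⬝ᵥ (T *ᵥ ((p : 𝕎 ≃ₗ[K] 𝕎) w).2) =
      w.1 ⬝ᵥ (T *ᵥ w'.2) - w'.1 ⬝ᵥ (T *ᵥ w.2) := by
  have h := (mem_symplecticGroup _ _).1 p.2 w w'
  simpa only [polar_apply, Matrix.toLinearMap₂'_apply'] using h

/-- `x ⬝ᵥ c_p x' = (a_p x) ⬝ᵥ T (d_p x')` (unfolding of `c_p`). [cite: Weil1964, Chap. III n° 46 p. 202] -/
theorem dotProduct_cMat_mulVec (p : Sp𝕎) (x x' : ι → K) :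
    x ⬝ᵥ (cMat p *ᵥ x') = (aMat p *ᵥ x) ⬝ᵥ (T *ᵥ (dMat p *ᵥ x')) := by
  rw [cMat, ← Matrix.mulVec_mulVec, ← Matrix.mulVec_mulVec, Matrix.dotProduct_mulVec, Matrix.vecMul_transpose]

/-- **`c_p` is symmetric** (the symplectic identity at `(x,0), (x',0)`). [cite: Weil1964, Chap. III n° 46 p. 202] -/
theorem cMat_isSymm (p : Sp𝕎) : (cMat p).IsSymm := by
  have key : ∀ x x' : ι → K, x ⬝ᵥ (cMat p *ᵥ x') = x' ⬝ᵥ (cMat p *ᵥ x) := by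
    intro x x'
    rw [dotProduct_cMat_mulVec, dotProduct_cMat_mulVec, aMat_mulVec, aMat_mulVec, dMat_mulVec, dMat_mulVec]
    have h := sp_identity p (x, 0) (x', 0)
    rw [Matrix.mulVec_zero, dotProduct_zero, dotProduct_zero, sub_self, sub_eq_zero] at h
    exact h
  refine matrix_eq_of_forall_dotProduct_mulVec fun x x' => ?_
  rw [Matrix.mulVec_transpose, dotProduct_comm, ← Matrix.dotProduct_mulVec, key]

/-- `a_pᵀ T e_p = T` (the symplectic identity at `(x,0), (0,y)`): the `Y → Y` block is the `β_T`-contragredient of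
`a_p`. [cite: Weil1964, Chap. III n° 46 p. 202] -/
theorem aMat_transpose_mul_eMat {p : Sp𝕎} (hp : p ∈ siegelParabolicPi T) : (aMat p)ᵀ * T * eMat p = T := by
  refine matrix_eq_of_forall_dotProduct_mulVec fun x y => ?_
  rw [← Matrix.mulVec_mulVec, ← Matrix.mulVec_mulVec, Matrix.dotProduct_mulVec x (aMat p)ᵀ,
    Matrix.vecMul_transpose, aMat_mulVec, eMat_mulVec]
  have h := sp_identity p (x, 0) (0, y)
  rw [hp.1 y, zero_dotProduct, sub_zero, Matrix.mulVec_zero, dotProduct_zero, sub_zero] at h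
  exact h

include hT in
/-- **`e_p = T⁻¹ a_p⁻ᵀ T`** for `p ∈ P_Y`. [cite: Weil1964, Chap. III n° 46 p. 202] -/
theorem eMat_eq {p : Sp𝕎} (hp : p ∈ siegelParabolicPi T) : eMat p = T⁻¹ * (aInvMat p)ᵀ * T := by
  have h1 : (aInvMat p)ᵀ * (aMat p)ᵀ = 1 := by
    rw [← Matrix.transpose_mul, aMat_mul_aInvMat hp, Matrix.transpose_one]
  have h2 : T * eMat p = (aInvMat p)ᵀ * T := by
    have h := congrArg (fun M => (aInvMat p)ᵀ * M) (aMat_transpose_mul_eMat hp)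
    simp only [← Matrix.mul_assoc, h1, Matrix.one_mul] at h
    exact h
  rw [Matrix.mul_assoc, ← h2, Matrix.nonsing_inv_mul_cancel_left T _ hT]

include hT in
/-- `(T⁻¹ a_p⁻ᵀ T)(T⁻¹ c_p) = d_p`: the unipotent part recovers the `X → Y` block. [cite: Weil1964, Chap. III n° 46 p. 202] -/
theorem leviDual_mul_lowLin_eq {p : Sp𝕎} (hp : p ∈ siegelParabolicPi T) :
    T⁻¹ * (aInvMat p)ᵀ * T * (T⁻¹ * cMat p) = dMat p := by
  rw [cMat, show T⁻¹ * (aInvMat p)ᵀ * T * (T⁻¹ * ((aMat p)ᵀ * T * dMat p)) =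
      T⁻¹ * (((aInvMat p)ᵀ * (aMat p)ᵀ) * (T * dMat p)) by
        simp only [Matrix.mul_assoc, Matrix.mul_nonsing_inv_cancel_left T _ hT],
    ← Matrix.transpose_mul, aMat_mul_aInvMat hp, Matrix.transpose_one, Matrix.one_mul,
    Matrix.nonsing_inv_mul_cancel_left T _ hT]

/-- **THE DECOMPOSITION `p = m(a_p) · n(c_p)` of an element of the Siegel parabolic** (Weil's normal form (42) of
`P(X)`: `s = t'(h) t(g) d(λ)` uniquely; here in the tree's generators `leviSp`, `unipotentSp`).
[cite: Weil1964, Chap. III n° 46 p. 202] -/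
theorem eq_leviSp_mul_unipotentSp [Invertible (2 : K)] {p : Sp𝕎} (hp : p ∈ siegelParabolicPi T) :
    p = leviSp (Matrix.toLinearMap₂' K T) (glEquiv (aGL hp)) (leviDual T hT (aGL hp)) (leviDual_compat T hT _) *
      unipotentSp (Matrix.toLinearMap₂' K T) (lowLin T (cMat p)) (lowLin_symm T hT _ (cMat_isSymm p)) := by
  apply Subtype.ext
  apply LinearEquiv.ext
  intro w
  obtain ⟨x, y⟩ := w
  rw [apply_eq hp]
  show _ = (leviSp (Matrix.toLinearMap₂' K T) (glEquiv (aGL hp)) (leviDual T hT (aGL hp)) (leviDual_compat T hT _) :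
      𝕎 ≃ₗ[K] 𝕎)
    ((unipotentSp (Matrix.toLinearMap₂' K T) (lowLin T (cMat p)) (lowLin_symm T hT _ (cMat_isSymm p)) :
      𝕎 ≃ₗ[K] 𝕎) (x, y))
  rw [coe_unipotentSp, unipotentσ_apply, coe_leviSp_apply]
  dsimp only
  rw [glEquiv_apply, leviDual_apply, coe_aGL, coe_aGL_inv, lowLin_apply, aMat_mulVec]
  refine Prod.ext rfl ?_
  dsimp only
  rw [Matrix.mulVec_add, Matrix.mulVec_mulVec, leviDual_mul_lowLin_eq hT hp, ← eMat_eq hT hp, eMat_mulVec,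
    dMat_mulVec, dLin_apply, eLin_apply, add_comm]

include hT in
/-- **`p⁻¹(x, 0) = (a_p⁻¹ x, −T⁻¹ c_p a_p⁻¹ x)`** for `p ∈ P_Y`. [cite: Weil1964, Chap. III n° 46 p. 202] -/
theorem symm_apply_inl [Invertible (2 : K)] {p : Sp𝕎} (hp : p ∈ siegelParabolicPi T) (x : ι → K) :
    (p : 𝕎 ≃ₗ[K] 𝕎).symm (x, 0) = (aInvMat p *ᵥ x, -((T⁻¹ * cMat p) *ᵥ (aInvMat p *ᵥ x))) := by
  have h := congrArg (fun g : Sp𝕎 => (g : 𝕎 ≃ₗ[K] 𝕎) (aInvMat p *ᵥ x, -((T⁻¹ * cMat p) *ᵥ (aInvMat p *ᵥ x))))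
    (eq_leviSp_mul_unipotentSp hT hp)
  rw [LinearEquiv.symm_apply_eq, h]
  symm
  show (leviSp (Matrix.toLinearMap₂' K T) (glEquiv (aGL hp)) (leviDual T hT (aGL hp)) (leviDual_compat T hT _) :
      𝕎 ≃ₗ[K] 𝕎)
    ((unipotentSp (Matrix.toLinearMap₂' K T) (lowLin T (cMat p)) (lowLin_symm T hT _ (cMat_isSymm p)) :
      𝕎 ≃ₗ[K] 𝕎) (aInvMat p *ᵥ x, -((T⁻¹ * cMat p) *ᵥ (aInvMat p *ᵥ x)))) = (x, 0)
  rw [coe_unipotentSp, unipotentσ_apply, coe_leviSp_apply]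
  dsimp only
  rw [lowLin_apply, neg_add_cancel, glEquiv_apply, map_zero, coe_aGL, Matrix.mulVec_mulVec, aMat_mul_aInvMat hp,
    Matrix.one_mulVec]

end SiegelParabolicPi

end Parabolic

/-! ## §3 The adelic Siegel parabolic is `δ₀`-liftable: Weil's `𝐫₀` -/

section Adelic

variable (F : Type) [Field F] [NumberField F] {n : ℕ}
variable (T : Matrix (Fin n) (Fin n) (AdeleRing (𝓞 F) F)) (hT : IsUnit T.det)

local notation "𝔸F" => AdeleRing (𝓞 F) F
local notation "𝕎𝔸" => (Fin n → AdeleRing (𝓞 F) F) × (Fin n → AdeleRing (𝓞 F) F)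
local notation "Sp𝔸" => symplecticGroup (polar (adelicForm F (Fin n) T))

/-- **`Mp_ψ(W_𝔸)^{δ₀}`**: the implementing pairs whose operator fixes `δ₀` — `(MΦ)(0) = Φ(0)` for all `Φ`.
[cite: Weil1964, Chap. I n° 13 p. 160] -/
abbrev adelicMpZero : Subgroup (adelicMp F (Fin n) T) :=
  MpPsi.fixing (adelicSchrodinger F (Fin n) T) (evalZeroLM F (Fin n) : piSchwartzBruhat F (Fin n) → ℂ)

variable {F T}

/-- membership in `Mp_ψ(W_𝔸)^{δ₀}`, on underlying functions. [cite: Weil1964, Chap. I n° 13 p. 160] -/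
theorem mem_adelicMpZero_iff (p : adelicMp F (Fin n) T) :
    p ∈ adelicMpZero F T ↔ ∀ Φ : piSchwartzBruhat F (Fin n),
      ((MpPsi.toOp (adelicSchrodinger F (Fin n) T) p Φ : piSchwartzBruhat F (Fin n)) : (Fin n → 𝔸F) → ℂ) 0 =
        (Φ : (Fin n → 𝔸F) → ℂ) 0 := by
  simp only [MpPsi.mem_fixing_iff, MpPsi.toOp_apply, evalZeroLM_apply]

variable (F T)

/-- **the Levi pairs fix `δ₀`**: `(Φ ∘ a⁻¹)(0) = Φ(0)` for every `a ∈ GL_n(𝔸)`. [cite: Weil1964, Chap. I n° 13 p. 160] -/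
theorem leviPair_mem_adelicMpZero (a : GL (Fin n) 𝔸F) : leviPair F T hT a ∈ adelicMpZero F T := by
  rw [mem_adelicMpZero_iff]
  intro Φ
  rw [coe_toOp_leviPair, twist_apply, Matrix.zero_vecMul]

/-- **the unipotent pairs fix `δ₀`**: `ψ(q_c(0)) Φ(0) = Φ(0)` for every `c ∈ Sym_n(𝔸)`. [cite: Weil1964, Chap. I n° 13 p. 160] -/
theorem unipPair_mem_adelicMpZero (c : Matrix (Fin n) (Fin n) 𝔸F) (hc : c.IsSymm) :
    unipPair F T hT c hc ∈ adelicMpZero F T := by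
  rw [mem_adelicMpZero_iff]
  intro Φ
  rw [coe_toOp_unipPair, chirp_apply, sdChar_apply, Matrix.zero_vecMul, zero_dotProduct, AddChar.map_zero_eq_one,
    Circle.coe_one, one_mul]

include hT in
/-- **every element of `P_Y(𝔸)` is `δ₀`-liftable** (via `p = m(a_p) n(c_p)` and the two explicit pairs).
[cite: Weil1964, Chap. I n° 13 p. 160] -/
theorem siegelParabolicPi_le_liftable :
    siegelParabolicPi T ≤
      liftable (adelicSchrodinger F (Fin n) T) (evalZeroLM F (Fin n) : piSchwartzBruhat F (Fin n) → ℂ) := by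
  intro p hp
  rw [SiegelParabolicPi.eq_leviSp_mul_unipotentSp hT hp]
  refine Subgroup.mul_mem _ ?_ ?_
  · exact (mem_liftable_iff _ _ _).2 ⟨leviPair F T hT _, leviPair_mem_adelicMpZero F T hT _, proj_leviPair F T hT _⟩
  · exact (mem_liftable_iff _ _ _).2
      ⟨unipPair F T hT _ (SiegelParabolicPi.cMat_isSymm p), unipPair_mem_adelicMpZero F T hT _ _,
        proj_unipPair F T hT _ _⟩

/-- **WEIL'S `𝐫₀` ON THE ADELIC SIEGEL PARABOLIC**: the unique `δ₀`-fixing homomorphic section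
`P_Y(𝔸) →* Mp_ψ(W_𝔸)` of `π` (the `δ₀`-forced lift of `AdelicMetaplecticGroup` §1 on `P_Y(𝔸)`); normalisation: the
tree's (`|det a|^{1/2}` omitted, see the module docstring). [cite: Weil1964, Chap. I n° 13 p. 160] -/
def adelicSiegelLift : siegelParabolicPi T →* adelicMp F (Fin n) T :=
  (forcedLift (deltaRigid_adelicSchrodinger F (Fin n) T)).comp
    (Subgroup.inclusion (siegelParabolicPi_le_liftable F T hT))

/-- `π ∘ 𝐫₀ = ` the inclusion `P_Y(𝔸) ≤ Sp(W_𝔸)`. [cite: Weil1964, Chap. I n° 13 p. 160] -/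
@[simp] theorem proj_adelicSiegelLift (p : siegelParabolicPi T) :
    MpPsi.proj _ (adelicSiegelLift F T hT p) = (p : Sp𝔸) :=
  proj_forcedLift (deltaRigid_adelicSchrodinger F (Fin n) T) _

/-- the values of `𝐫₀` fix `δ₀`. [cite: Weil1964, Chap. I n° 13 p. 160] -/
theorem adelicSiegelLift_mem_adelicMpZero (p : siegelParabolicPi T) : adelicSiegelLift F T hT p ∈ adelicMpZero F T :=
  forcedLift_mem_fixing (deltaRigid_adelicSchrodinger F (Fin n) T) _

/-- **UNIQUENESS**: a `δ₀`-fixing pair over `p ∈ P_Y(𝔸)` IS `𝐫₀(p)`. [cite: Weil1964, Chap. I n° 13 p. 160] -/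
theorem eq_adelicSiegelLift {p : siegelParabolicPi T} {q : adelicMp F (Fin n) T} (hq : q ∈ adelicMpZero F T)
    (hpq : MpPsi.proj _ q = (p : Sp𝔸)) : q = adelicSiegelLift F T hT p :=
  MpPsi.eq_of_proj_eq_of_mem_fixing (deltaRigid_adelicSchrodinger F (Fin n) T) hq
    (adelicSiegelLift_mem_adelicMpZero F T hT p) (by rw [hpq, proj_adelicSiegelLift])

/-- `𝐫₀(m(a)) = leviPair a` (`d₀`). [cite: Weil1964, Chap. I n° 13 p. 160] -/
theorem adelicSiegelLift_leviSp (a : GL (Fin n) 𝔸F) :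
    adelicSiegelLift F T hT ⟨_, leviSp_mem_siegelParabolicPi T hT a⟩ = leviPair F T hT a :=
  (eq_adelicSiegelLift F T hT (leviPair_mem_adelicMpZero F T hT a) (proj_leviPair F T hT a)).symm

/-- `𝐫₀(n(c)) = unipPair c` (`t₀`). [cite: Weil1964, Chap. I n° 13 p. 160] -/
theorem adelicSiegelLift_unipotentSp (c : Matrix (Fin n) (Fin n) 𝔸F) (hc : c.IsSymm) :
    adelicSiegelLift F T hT ⟨_, unipotentSp_mem_siegelParabolicPi T hT c hc⟩ = unipPair F T hT c hc :=
  (eq_adelicSiegelLift F T hT (unipPair_mem_adelicMpZero F T hT c hc) (proj_unipPair F T hT c hc)).symm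

/-- **`𝐫₀(p) = leviPair a_p · unipPair c_p`** (`𝐫₀` is a homomorphism and `p = m(a_p) n(c_p)`).
[cite: Weil1964, Chap. I n° 13 p. 160] -/
theorem adelicSiegelLift_eq_leviPair_mul_unipPair (p : siegelParabolicPi T) :
    adelicSiegelLift F T hT p =
      leviPair F T hT (SiegelParabolicPi.aGL p.2) *
        unipPair F T hT (SiegelParabolicPi.cMat (p : Sp𝔸)) (SiegelParabolicPi.cMat_isSymm _) := by
  symm
  refine eq_adelicSiegelLift F T hT (Subgroup.mul_mem _ (leviPair_mem_adelicMpZero F T hT _)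
    (unipPair_mem_adelicMpZero F T hT _ _)) ?_
  rw [map_mul, proj_leviPair, proj_unipPair]
  exact (SiegelParabolicPi.eq_leviSp_mul_unipotentSp hT p.2).symm

/-- **the values of `𝐫₀` are LF-continuous**: `𝐫₀(P_Y(𝔸)) ⊆ Mp_ψ(W_𝔸)ᶜᵒⁿᵗ`. [cite: Weil1964, Chap. I n° 11 p. 158] -/
theorem adelicSiegelLift_mem_adelicMpCont (p : siegelParabolicPi T) :
    adelicSiegelLift F T hT p ∈ adelicMpCont F (Fin n) T := by
  rw [adelicSiegelLift_eq_leviPair_mul_unipPair]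
  exact Subgroup.mul_mem _ (leviPair_mem_adelicMpCont F T hT _) (unipPair_mem_adelicMpCont F T hT _ _)

/-- **`𝐫₀ : P_Y(𝔸) →* Mp_ψ(W_𝔸)ᶜᵒⁿᵗ`**, Weil's lift with values in the metaplectic group of record.
[cite: Weil1964, Chap. I n° 13 p. 160] -/
def adelicSiegelLiftCont : siegelParabolicPi T →* adelicMpCont F (Fin n) T :=
  (adelicSiegelLift F T hT).codRestrict _ (adelicSiegelLift_mem_adelicMpCont F T hT)

/-- underlying pair. [cite: Weil1964, Chap. I n° 13 p. 160] -/
@[simp] theorem coe_adelicSiegelLiftCont (p : siegelParabolicPi T) :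
    (adelicSiegelLiftCont F T hT p : adelicMp F (Fin n) T) = adelicSiegelLift F T hT p := rfl

/-- `π(𝐫₀ p) = p` in the group of record. [cite: Weil1964, Chap. I n° 13 p. 160] -/
@[simp] theorem proj_adelicSiegelLiftCont (p : siegelParabolicPi T) :
    adelicMpCont.proj F (Fin n) T (adelicSiegelLiftCont F T hT p) = (p : Sp𝔸) :=
  proj_adelicSiegelLift F T hT p

/-- **OPERATOR FORMULA** in the coordinates `a_p, c_p`: `(ω(𝐫₀ p)Φ)(x) = ψ_F(q_{−½c_p}(a_p⁻¹x)) Φ(a_p⁻¹ x)`.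
[cite: Kudla1996, I.2] -/
theorem coe_toOp_adelicSiegelLift (p : siegelParabolicPi T) (Φ : piSchwartzBruhat F (Fin n)) (x : Fin n → 𝔸F) :
    ((MpPsi.toOp (adelicSchrodinger F (Fin n) T) (adelicSiegelLift F T hT p) Φ : piSchwartzBruhat F (Fin n)) :
        (Fin n → 𝔸F) → ℂ) x =
      sdChar F ((-⅟(2 : 𝔸F)) • SiegelParabolicPi.cMat (p : Sp𝔸)) (SiegelParabolicPi.aInvMat (p : Sp𝔸) *ᵥ x) *
        (Φ : (Fin n → 𝔸F) → ℂ) (SiegelParabolicPi.aInvMat (p : Sp𝔸) *ᵥ x) := by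
  have h := congrArg (MpPsi.toOp (adelicSchrodinger F (Fin n) T)) (adelicSiegelLift_eq_leviPair_mul_unipPair F T hT p)
  rw [map_mul] at h
  simp only [h, LinearEquiv.mul_apply, coe_toOp_leviPair, twist_apply, coe_trInv, SiegelParabolicPi.coe_aGL_inv,
    Matrix.vecMul_transpose, coe_toOp_unipPair, chirp_apply]

/-- **OPERATOR FORMULA, intrinsic form**: `(ω(𝐫₀ p)Φ)(x) = ψ_F(½ β_T(u, v)) Φ(u)` where `(u, v) = p⁻¹(x, 0)` —
Weil's `t₀(f) d₀(λ)`, Kudla's `A(m(a))A(n(b))`. [cite: Weil1964, Chap. I n° 13 p. 160] -/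
theorem coe_toOp_adelicSiegelLift_symm (p : siegelParabolicPi T) (Φ : piSchwartzBruhat F (Fin n))
    (x : Fin n → 𝔸F) :
    ((MpPsi.toOp (adelicSchrodinger F (Fin n) T) (adelicSiegelLift F T hT p) Φ : piSchwartzBruhat F (Fin n)) :
        (Fin n → 𝔸F) → ℂ) x =
      (adeleAddChar F (⅟(2 : 𝔸F) *
          ((((p : Sp𝔸) : 𝕎𝔸 ≃ₗ[𝔸F] 𝕎𝔸).symm (x, 0)).1 ⬝ᵥ (T *ᵥ (((p : Sp𝔸) : 𝕎𝔸 ≃ₗ[𝔸F] 𝕎𝔸).symm (x, 0)).2))) : ℂ) *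
        (Φ : (Fin n → 𝔸F) → ℂ) (((p : Sp𝔸) : 𝕎𝔸 ≃ₗ[𝔸F] 𝕎𝔸).symm (x, 0)).1 := by
  have hs := SiegelParabolicPi.symm_apply_inl hT p.2 x
  rw [coe_toOp_adelicSiegelLift]
  simp only [hs, sdChar_apply]
  congr 3
  rw [Matrix.mulVec_neg, Matrix.mulVec_mulVec, Matrix.mul_nonsing_inv_cancel_left T _ hT, dotProduct_neg,
    Matrix.vecMul_smul, smul_dotProduct, smul_eq_mul,
    ← Matrix.dotProduct_mulVec (SiegelParabolicPi.aInvMat _ *ᵥ x) (SiegelParabolicPi.cMat _), neg_mul, mul_neg]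

end Adelic

/-! ## §4 Continuity of `𝐫₀` -/

section Continuity

variable (F : Type) [Field F] [NumberField F] {n : ℕ}
variable (T : Matrix (Fin n) (Fin n) (AdeleRing (𝓞 F) F)) (hT : IsUnit T.det)

local notation "𝔸F" => AdeleRing (𝓞 F) F
local notation "𝕎𝔸" => (Fin n → AdeleRing (𝓞 F) F) × (Fin n → AdeleRing (𝓞 F) F)
local notation "Sp𝔸" => symplecticGroup (polar (adelicForm F (Fin n) T))

/-- **CONTINUITY OF `𝐫₀` ALONG CONTINUOUS FAMILIES**: if `z ↦ p_z w` and `z ↦ p_z⁻¹ w` are continuous into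
`W_𝔸 = 𝔸_Fⁿ × 𝔸_Fⁿ` for every `w`, then `z ↦ 𝐫₀(p_z)` is continuous for the topology of `Mp_ψ(W_𝔸)` (initial
topology of `π` and of the matrix coefficients `(ω(·)Φ)(x)`): by the operator formula, the coefficients are
`ψ_F(½β_T(u_z, v_z)) Φ(u_z)` with `(u_z, v_z) = p_z⁻¹(x, 0)` and `Φ` continuous.  This is the form consumed when a
continuous homomorphism `g ↦ p_g ∈ P_Y(𝔸)` from an adelic group is composed with `𝐫₀`.
[cite: Weil1964, Chap. III n° 39 p. 189] -/
theorem continuous_adelicSiegelLift_comp {Z : Type*} [TopologicalSpace Z] (f : Z → siegelParabolicPi T)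
    (h₁ : ∀ w : 𝕎𝔸, Continuous fun z => ((f z : Sp𝔸) : 𝕎𝔸 ≃ₗ[𝔸F] 𝕎𝔸) w)
    (h₂ : ∀ w : 𝕎𝔸, Continuous fun z => ((f z : Sp𝔸) : 𝕎𝔸 ≃ₗ[𝔸F] 𝕎𝔸).symm w) :
    Continuous fun z => adelicSiegelLift F T hT (f z) := by
  rw [continuous_into_adelicMp_iff]
  refine ⟨fun w => ?_, fun Φ x => ?_⟩
  · simp_rw [proj_adelicSiegelLift]
    exact h₁ w
  · simp_rw [omegaPsi_apply, ← MpPsi.toOp_apply, coe_toOp_adelicSiegelLift_symm]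
    have hw := h₂ (x, 0)
    refine Continuous.mul ?_ ((continuous_of_mem_piSchwartzBruhat Φ.2).comp hw.fst)
    exact continuous_subtype_val.comp ((continuous_adeleAddChar F).comp
      (continuous_const.mul (hw.fst.dotProduct (continuous_const.matrix_mulVec hw.snd))))

/-- the pair of orbit maps `(w ↦ p w, w ↦ p⁻¹ w)` of `p ∈ P_Y(𝔸)`. [folklore] -/
def siegelParabolicPiOrbit (p : siegelParabolicPi T) : (𝕎𝔸 → 𝕎𝔸) × (𝕎𝔸 → 𝕎𝔸) :=
  (⇑((p : Sp𝔸) : 𝕎𝔸 ≃ₗ[𝔸F] 𝕎𝔸), ⇑((p : Sp𝔸) : 𝕎𝔸 ≃ₗ[𝔸F] 𝕎𝔸).symm)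

/-- **the topology of `P_Y(𝔸)`**: pointwise convergence of `p` and `p⁻¹` on `W_𝔸` (the adelic topology on the matrix
entries of `p`, `p⁻¹`). [folklore] -/
instance topologicalSpace_siegelParabolicPi : TopologicalSpace (siegelParabolicPi T) :=
  TopologicalSpace.induced (siegelParabolicPiOrbit F T) inferInstance

/-- the orbit maps `p ↦ p w` are continuous on `P_Y(𝔸)`. [folklore] -/
private theorem continuous_siegelParabolicPi_apply (w : 𝕎𝔸) :
    Continuous fun p : siegelParabolicPi T => ((p : Sp𝔸) : 𝕎𝔸 ≃ₗ[𝔸F] 𝕎𝔸) w := by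
  have h : Continuous fun p : siegelParabolicPi T => (siegelParabolicPiOrbit F T p).1 w :=
    (continuous_apply w).comp (continuous_fst.comp continuous_induced_dom)
  exact h

/-- the orbit maps `p ↦ p⁻¹ w` are continuous on `P_Y(𝔸)`. [folklore] -/
private theorem continuous_siegelParabolicPi_symm_apply (w : 𝕎𝔸) :
    Continuous fun p : siegelParabolicPi T => ((p : Sp𝔸) : 𝕎𝔸 ≃ₗ[𝔸F] 𝕎𝔸).symm w := by
  have h : Continuous fun p : siegelParabolicPi T => (siegelParabolicPiOrbit F T p).2 w :=
    (continuous_apply w).comp (continuous_snd.comp continuous_induced_dom)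
  exact h

/-- **`𝐫₀ : P_Y(𝔸) → Mp_ψ(W_𝔸)ᶜᵒⁿᵗ` is continuous.** [cite: Weil1964, Chap. III n° 39 p. 189] -/
theorem continuous_adelicSiegelLiftCont : Continuous (adelicSiegelLiftCont F T hT) :=
  (continuous_into_adelicMpCont_iff _).2
    (continuous_adelicSiegelLift_comp F T hT id (continuous_siegelParabolicPi_apply F T)
      (continuous_siegelParabolicPi_symm_apply F T))

end Continuity

/-! ## §5 Rationality: `𝐫₀ = r_F` on `P_Y(F)` -/

section Rational

variable (F : Type) [Field F] [NumberField F] {n : ℕ}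
variable (T : Matrix (Fin n) (Fin n) (AdeleRing (𝓞 F) F)) (hT : IsUnit T.det)

local notation "Sp𝔸" => symplecticGroup (polar (adelicForm F (Fin n) T))

/-- **`P_Y(F) ≤ P_Y(𝔸)`**: the subgroup generated by the rational Levi elements `m(γ)`, `γ ∈ GL_n(F)`, and the
rational unipotents `n(σ)`, `σ ∈ Sym_n(F)` (`P(F) = M(F)N(F)`). [cite: Weil1964, Chap. III n° 46 p. 202] -/
def ratSiegelParabolicPi : Subgroup (siegelParabolicPi T) :=
  Subgroup.closure
    ({p | ∃ γ : GL (Fin n) F, (p : Sp𝔸) =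
        leviSp (adelicForm F (Fin n) T) (glEquiv (ratGL F γ)) (leviDual T hT (ratGL F γ))
          (leviDual_compat T hT (ratGL F γ))} ∪
      {p | ∃ (σ : Matrix (Fin n) (Fin n) F) (hσ : σ.IsSymm), (p : Sp𝔸) =
        unipotentSp (adelicForm F (Fin n) T) (lowLin T (ratMatrix F σ)) (lowLin_symm T hT _ (hσ.map _))})

/-- **on `P_Y(F)` the values of `𝐫₀` fix `Θ`** (the rational Levi and unipotent pairs do: `thetaDist_twist_ratGL`,
`thetaDist_chirp_ratMatrix`; `𝐫₀` is a homomorphism and `Mp_ψ(W_𝔸)^Θ` a subgroup).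
[cite: Weil1964, Chap. III n° 41 Thm 6 p. 193] -/
theorem adelicSiegelLift_mem_adelicMpTheta {p : siegelParabolicPi T} (hp : p ∈ ratSiegelParabolicPi F T hT) :
    adelicSiegelLift F T hT p ∈ adelicMpTheta F (Fin n) T := by
  change p ∈ (adelicMpTheta F (Fin n) T).comap (adelicSiegelLift F T hT)
  refine (Subgroup.closure_le _).2 ?_ hp
  rintro q (⟨γ, hγ⟩ | ⟨σ, hσ, hq⟩)
  · rw [SetLike.mem_coe, Subgroup.mem_comap,
      ← eq_adelicSiegelLift F T hT (leviPair_mem_adelicMpZero F T hT (ratGL F γ))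
        ((proj_leviPair F T hT (ratGL F γ)).trans hγ.symm)]
    exact leviPair_ratGL_mem_adelicMpTheta F T hT γ
  · rw [SetLike.mem_coe, Subgroup.mem_comap,
      ← eq_adelicSiegelLift F T hT (unipPair_mem_adelicMpZero F T hT (ratMatrix F σ) (hσ.map _))
        ((proj_unipPair F T hT (ratMatrix F σ) (hσ.map _)).trans hq.symm)]
    exact unipPair_ratMatrix_mem_adelicMpTheta F T hT σ (hσ.map _)

/-- **`P_Y(F) ⊆ Sp_F(W)`**: every element of `P_Y(F)` is a rational point of `Sp(W_𝔸)` (`m(γ) = ratSp (levi γ)`,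
`n(σ) = ratSp (low σ)`). [cite: Weil1964, Chap. III n° 37 p. 188] -/
theorem coe_mem_range_ratSp {p : siegelParabolicPi T} (hp : p ∈ ratSiegelParabolicPi F T hT) :
    (p : Sp𝔸) ∈ (ratSp F T hT).range := by
  change p ∈ ((ratSp F T hT).range).comap (siegelParabolicPi T).subtype
  refine (Subgroup.closure_le _).2 ?_ hp
  haveI : Invertible (2 : F) := invertibleOfNonzero two_ne_zero
  rintro q (⟨γ, hγ⟩ | ⟨σ, hσ, hq⟩)
  · rw [SetLike.mem_coe, Subgroup.mem_comap, Subgroup.coe_subtype, hγ, ← ratSp_levi]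
    exact ⟨_, rfl⟩
  · rw [SetLike.mem_coe, Subgroup.mem_comap, Subgroup.coe_subtype, hq, ← ratSp_low F T hT σ hσ]
    exact ⟨_, rfl⟩

/-- **`𝐫₀ = r_F` ON `P_Y(F)`**: for `p ∈ P_Y(F)`, `𝐫₀(p)` is Weil's `Θ`-forced lift of the rational point `p`
(`Θ`-rigidity: both are `Θ`-fixing pairs over `p`). [cite: Weil1964, Chap. III n° 41 Thm 6 p. 193] -/
theorem adelicSiegelLiftCont_eq_ratPointsThetaLiftCont {p : siegelParabolicPi T}
    (hp : p ∈ ratSiegelParabolicPi F T hT) :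
    adelicSiegelLiftCont F T hT p =
      ratPointsThetaLiftCont F (Fin n) T hT ⟨(p : Sp𝔸), coe_mem_range_ratSp F T hT hp⟩ :=
  Subtype.ext (coe_ratPointsThetaLiftCont_eq F (Fin n) T hT (adelicSiegelLift_mem_adelicMpTheta F T hT hp)
    (proj_adelicSiegelLift F T hT p)).symm

end Rational

/-! ## §6 The Siegel splitting datum and its compatible splitting -/

section Datum

open Literature.NumberTheory.GelbartRogawski1991

variable (F : Type) [Field F] [NumberField F] {n : ℕ}
variable (T : Matrix (Fin n) (Fin n) (AdeleRing (𝓞 F) F)) (hT : IsUnit T.det)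

local notation "Sp𝔸" => symplecticGroup (polar (adelicForm F (Fin n) T))

/-- **The Siegel splitting datum**: the abstract datum of [GelbartRogawski1991, §3.1 p. 454] (`Sp ⊇ Sp_F(W)`,
`Mp` with `π`, `G(𝐀) ⊇ G(F)` with `ι`, the splitting `i` of `π` over `Sp_F(W)`) instantiated at `Sp := Sp(W_𝔸)`,
`Mp := Mp_ψ(W_𝔸)ᶜᵒⁿᵗ`, `π := proj`, **`G(𝐀) := P_Y(𝔸)`** (inclusion), `G(F) := P_Y(F)`, `Sp_F(W) := ratSp(Sp_{2n}(F))`,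
`i := r_F` (`ratPointsThetaLiftCont`).  All fields constructed. [cite: GelbartRogawski1991, §3.1 p. 454 L21–48] -/
def siegelSplittingDatum : SplittingDatum Sp𝔸 (adelicMpCont F (Fin n) T) (siegelParabolicPi T) where
  proj := adelicMpCont.proj F (Fin n) T
  toSp := (siegelParabolicPi T).subtype
  ratPts := ratSiegelParabolicPi F T hT
  spRat := ((transportSp T hT).comp (mapHom (algebraMap F (AdeleRing (𝓞 F) F)))).range
  toSp_mem_spRat _ hγ := coe_mem_range_ratSp F T hT hγ
  ratSplit := ratPointsThetaLiftCont F (Fin n) T hT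
  proj_ratSplit := proj_ratPointsThetaLiftCont F (Fin n) T hT

/-- **THE METAPLECTIC COVER `Mp_ψ(W_𝔸)ᶜᵒⁿᵗ → Sp(W_𝔸)` ADMITS A COMPATIBLE SPLITTING OVER THE ADELIC SIEGEL PARABOLIC**:
`𝐫₀ : P_Y(𝔸) →* Mp_ψ(W_𝔸)ᶜᵒⁿᵗ` is continuous, lies over the inclusion, and carries `P_Y(F)` into `r_F(Sp_F(W))` —
`(siegelSplittingDatum F T hT).CompatibleSplitting`.  (An inhabitant of the record predicate
`SplittingDatum.CompatibleSplitting` at a constructed adelic datum with non-trivial `G(𝐀)`; not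
[GelbartRogawski1991, Prop. 3.1.1], whose `G` is a unitary group.)
[cite: Weil1964, Chap. I n° 13 p. 160; Rangarao1993, Thm 3.5 (3) p. 355] -/
theorem compatibleSplitting_siegelSplittingDatum : (siegelSplittingDatum F T hT).CompatibleSplitting :=
  ⟨adelicSiegelLiftCont F T hT, continuous_adelicSiegelLiftCont F T hT, fun p => proj_adelicSiegelLiftCont F T hT p,
    fun _ hγ => ⟨⟨_, coe_mem_range_ratSp F T hT hγ⟩, (adelicSiegelLiftCont_eq_ratPointsThetaLiftCont F T hT hγ).symm⟩⟩

/-- the compatible splitting of the Siegel datum, named: it IS `𝐫₀`. [cite: GelbartRogawski1991, §3.1 Remark p. 457 L4] -/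
theorem isCompatible_adelicSiegelLiftCont :
    (siegelSplittingDatum F T hT).IsCompatible (adelicSiegelLiftCont F T hT) :=
  ⟨fun p => proj_adelicSiegelLiftCont F T hT p,
    fun _ hγ => ⟨⟨_, coe_mem_range_ratSp F T hT hγ⟩, (adelicSiegelLiftCont_eq_ratPointsThetaLiftCont F T hT hγ).symm⟩⟩

end Datum

end Literature.NumberTheory.Weil1964

end
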